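import Mathlib
import Literature.Barriers.Parity.FordMaynardPrimeSieves
import Literature.NumberTheory.Sieve.FordMaynardLevelHalfSieve

/-!
# Route `FordMaynardSieveConst01651`, target `SieveConst01651` (stmt-Parity-19185), line `sieve_decomposition`:
# helpers towards `stub_typeIIRegion` (Ford–Maynard Proposition 7.19 / 7.22) — the Type-II end of the proof

K. Ford, J. Maynard, *On the theory of prime producing sieves*, arXiv:2407.14368v1, §7.1 and the last step of the
proof of Proposition 7.22 (p. 43, display (eq:sieve-final)): after all polytope / box conditions are encoded, the sum
`∑_{n = n₁⋯n_N ∼ x, ∏_{e ∈ E} n_e ∈ ((x/2)^θ, x^{θ+ν}]} w_n υ₁(n₁)⋯υ_N(n_N)` with `1`-bounded `υ_j` is a Type-II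
bilinear form whose coefficients `Y₁(n') = ∑_{n' = ∏_{e∈E} n_e} ∏ υ_e(n_e)`, `Y₂(n'')` (the complementary product)
are bounded by `τ_{|E|}(n') ≤ τ(n')^{|E|−1}` (Lemma 7.7), hence admissible in (II) once `B ≥ |E|, N − |E|`.

This file proves, def-free and in the tree's vocabulary (`Nat.finMulAntidiag k n` = the `k`-tuples with product
`n`, so that `τ_k(n) = #(Nat.finMulAntidiag k n)`; `FordMaynard.TypeII`):
* `card_finMulAntidiag_le_pow` — **Lemma 7.7**, `τ_k(n) ≤ τ(n)^{k−1}` (`n ≥ 1`), by the injection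
  `t ↦ (t₁, …, t_{k−1}) ∈ (divisors n)^{k−1}` (the last coordinate is determined);
* `norm_tupleCoeff_le_card`, `norm_tupleCoeff_le_rpow` — `|Y(n')| ≤ τ_k(n') ≤ τ(n')^B` for `1`-bounded `υ` and
  real `B ≥ k − 1`, `B ≥ 0`: the coefficient sequences of (eq:sieve-final) satisfy the hypotheses of `TypeII`;
* `typeII_apply_tupleCoeff` — the Type-II bound (II) applied to two such coefficient sequences;
* the second half of Ford–Maynard's growth condition (w), `w_n ≥ −x^{ν/10}` (p. 5), which the tree's `GrowthBound`
  omits and the registered `stub_typeIIRegion` therefore lacks (evidence #22 on the item): it holds for free for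
  `w = a − 1`, `a ≥ 0`, `x ≥ 1` (`neg_rpow_le_sub_one`), and yields Lemma 7.10's `|w_n| ≤ w_n + 2x^{ν/10}`
  (`abs_le_self_add_two_mul`, `sum_abs_le_sum_add`) — the form in which the repaired stub is discharged inside the
  skeleton's `fm73aClosed_of` (which applies the stub only to `w = a − 1`, `a ≥ 0`).
Nothing here proves anything about the Parity summit; one leaf's stub is served, not closed.
-/

noncomputable section

open Finset

namespace Summit.Parity.GeneralizedHardyLittlewood.FordMaynardSieveConst01651SieveConst01651

/-! ### Lemma 7.7: `τ_k(n) ≤ τ(n)^{k-1}` -/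

/-- **Ford–Maynard, Lemma 7.7** (`τ_k(n) ≤ τ(n)^{k−1}` for positive integers `k, n`), over Mathlib's
`Nat.finMulAntidiag`: the number of `(k+1)`-tuples of naturals with product `n ≠ 0` is at most `τ(n)^k`.
Proof (not the printed multiplicative one): `t ↦ (t₀, …, t_{k−1})` maps the tuples injectively into
`(divisors n)^k`, the last coordinate being determined by the product.
[cite: FordMaynard2024PrimeSieves, Lemma 7.7] -/
theorem card_finMulAntidiag_succ_le_pow (k : ℕ) {n : ℕ} (hn : n ≠ 0) :
    (Nat.finMulAntidiag (k + 1) n).card ≤ n.divisors.card ^ k := by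
  classical
  have hmaps : Set.MapsTo (fun t : Fin (k + 1) → ℕ => Fin.init t) (Nat.finMulAntidiag (k + 1) n : Set _)
      (Fintype.piFinset (fun _ : Fin k => n.divisors) : Set (Fin k → ℕ)) := by
    intro t ht
    rw [Finset.mem_coe] at ht ⊢
    rw [Fintype.mem_piFinset]
    intro i
    rw [Nat.mem_divisors]
    exact ⟨Nat.dvd_of_mem_finMulAntidiag ht _, hn⟩
  have hinj : Set.InjOn (fun t : Fin (k + 1) → ℕ => Fin.init t) (Nat.finMulAntidiag (k + 1) n : Set _) := by
    intro t ht t' ht' h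
    rw [Finset.mem_coe] at ht ht'
    have hp := Nat.prod_eq_of_mem_finMulAntidiag ht
    have hp' := Nat.prod_eq_of_mem_finMulAntidiag ht'
    rw [Fin.prod_univ_castSucc] at hp hp'
    have hinit : ∏ i : Fin k, t (Fin.castSucc i) = ∏ i : Fin k, t' (Fin.castSucc i) := by
      have := congrArg (fun f : Fin k → ℕ => ∏ i, f i) h
      simpa only [Fin.init] using this
    have hP0 : ∏ i : Fin k, t' (Fin.castSucc i) ≠ 0 := by
      intro h0
      rw [h0, zero_mul] at hp'
      exact hn hp'.symm
    have hlast : t (Fin.last k) = t' (Fin.last k) := by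
      rw [hinit] at hp
      exact mul_left_cancel₀ hP0 (hp.trans hp'.symm)
    funext i
    refine Fin.lastCases ?_ (fun j => ?_) i
    · exact hlast
    · have := congrFun h j
      simpa only [Fin.init] using this
  calc (Nat.finMulAntidiag (k + 1) n).card
      ≤ (Fintype.piFinset (fun _ : Fin k => n.divisors)).card :=
        Finset.card_le_card_of_injOn _ hmaps hinj
    _ = n.divisors.card ^ k := by
        rw [Fintype.card_piFinset, Finset.prod_const, Finset.card_univ, Fintype.card_fin]

/-- **Lemma 7.7**, all `k`: `τ_k(n) = #(Nat.finMulAntidiag k n) ≤ τ(n)^{k−1}` for `n ≠ 0` (for `k = 0` the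
left side is `≤ 1 = τ(n)^0`). [cite: FordMaynard2024PrimeSieves, Lemma 7.7] -/
theorem card_finMulAntidiag_le_pow (k : ℕ) {n : ℕ} (hn : n ≠ 0) :
    (Nat.finMulAntidiag k n).card ≤ n.divisors.card ^ (k - 1) := by
  rcases k with _ | k
  · rw [Nat.zero_sub, pow_zero]
    exact Finset.card_le_one.mpr fun a _ b _ => funext fun i => Fin.elim0 i
  · rw [Nat.add_sub_cancel]
    exact card_finMulAntidiag_succ_le_pow k hn

/-! ### The coefficient sequences of (eq:sieve-final): `1`-bounded tuple sums are `τ`-power bounded -/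

/-- `|∑_{n = n₁⋯n_k} ∏ᵢ υᵢ(nᵢ)| ≤ τ_k(n)` for `1`-bounded `υᵢ` (the bound `|Y₁(n')| ≤ τ_{|E|}(n')` of the proof of
Proposition 7.22). [cite: FordMaynard2024PrimeSieves, proof of Proposition 7.22 (display (eq:sieve-final))] -/
theorem norm_tupleCoeff_le_card {k : ℕ} (υ : Fin k → ℕ → ℂ) (hυ : ∀ i a, ‖υ i a‖ ≤ 1) (n : ℕ) :
    ‖∑ t ∈ Nat.finMulAntidiag k n, ∏ i, υ i (t i)‖ ≤ ((Nat.finMulAntidiag k n).card : ℝ) := by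
  calc ‖∑ t ∈ Nat.finMulAntidiag k n, ∏ i, υ i (t i)‖
      ≤ ∑ t ∈ Nat.finMulAntidiag k n, ‖∏ i, υ i (t i)‖ := norm_sum_le _ _
    _ ≤ ∑ _t ∈ Nat.finMulAntidiag k n, (1 : ℝ) := by
        refine Finset.sum_le_sum fun t _ => ?_
        rw [norm_prod]
        exact Finset.prod_le_one (fun i _ => norm_nonneg _) (fun i _ => hυ i _)
    _ = ((Nat.finMulAntidiag k n).card : ℝ) := by simp

/-- `|∑_{n = n₁⋯n_k} ∏ᵢ υᵢ(nᵢ)| ≤ τ(n)^B` for `1`-bounded `υᵢ` and real `B ≥ max(k − 1, 0)` — the shape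
`‖ξ m‖ ≤ τ(m)^B` / `‖κ n‖ ≤ τ(n)^B` demanded by `FordMaynard.TypeII` ("(eq:sieve-final) follows from the Type II
bound if `B` is sufficiently large"). [cite: FordMaynard2024PrimeSieves, Lemma 7.7 and proof of Proposition 7.22] -/
theorem norm_tupleCoeff_le_rpow {k : ℕ} (υ : Fin k → ℕ → ℂ) (hυ : ∀ i a, ‖υ i a‖ ≤ 1) {B : ℝ} (hB0 : 0 ≤ B)
    (hBk : (k : ℝ) - 1 ≤ B) (n : ℕ) :
    ‖∑ t ∈ Nat.finMulAntidiag k n, ∏ i, υ i (t i)‖ ≤ (n.divisors.card : ℝ) ^ B := by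
  rcases eq_or_ne n 0 with rfl | hn
  · simp only [Nat.finMulAntidiag_zero_right, Finset.sum_empty, norm_zero]
    exact Real.rpow_nonneg (Nat.cast_nonneg _) _
  refine (norm_tupleCoeff_le_card υ hυ n).trans ?_
  have hτ1 : (1 : ℝ) ≤ (n.divisors.card : ℝ) := by
    exact_mod_cast Finset.card_pos.mpr ⟨1, Nat.one_mem_divisors.mpr hn⟩
  calc ((Nat.finMulAntidiag k n).card : ℝ) ≤ ((n.divisors.card ^ (k - 1) : ℕ) : ℝ) := by
        exact_mod_cast card_finMulAntidiag_le_pow k hn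
    _ = (n.divisors.card : ℝ) ^ (((k - 1 : ℕ) : ℝ)) := by
        rw [Nat.cast_pow, Real.rpow_natCast]
    _ ≤ (n.divisors.card : ℝ) ^ B := by
        refine Real.rpow_le_rpow_of_exponent_le hτ1 ?_
        rcases k with _ | k
        · simpa using hB0
        · rw [Nat.add_sub_cancel]
          push_cast at hBk
          linarith

/-- **The Type-II bound applied to tuple coefficients** (the conclusion of the proof of Proposition 7.22): if `w`
satisfies (II) on `((x/2)^θ, x^{θ+ν}]` with exponent `B ≥ max(k − 1, l − 1, 0)`, then for `1`-bounded
`υ₁, …, υ_k` and `υ'₁, …, υ'_l`, with `ξ(m) = ∑_{m = m₁⋯m_k} ∏ υᵢ(mᵢ)` and `κ(n) = ∑_{n = n₁⋯n_l} ∏ υ'ⱼ(nⱼ)`,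
`|∑_{(x/2)^θ < m ≤ x^{θ+ν}} ∑_{x/2 < mn ≤ x} ξ(m) κ(n) w(mn)| ≤ x/(log x)^B`.
[cite: FordMaynard2024PrimeSieves, proof of Proposition 7.22 (display (eq:sieve-final))] -/
theorem typeII_apply_tupleCoeff {w : ℕ → ℝ} {x θ ν B : ℝ}
    (hII : Literature.Barriers.Parity.FordMaynard.TypeII w x θ ν B) {k l : ℕ}
    (υ : Fin k → ℕ → ℂ) (hυ : ∀ i a, ‖υ i a‖ ≤ 1) (υ' : Fin l → ℕ → ℂ) (hυ' : ∀ j a, ‖υ' j a‖ ≤ 1)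
    (hB0 : 0 ≤ B) (hBk : (k : ℝ) - 1 ≤ B) (hBl : (l : ℝ) - 1 ≤ B) :
    ‖∑ m ∈ (Icc 1 ⌊x ^ (θ + ν)⌋₊).filter (fun m : ℕ => (x / 2) ^ θ < (m : ℝ)),
        ∑ n ∈ (Icc 1 ⌊x⌋₊).filter (fun n : ℕ => x / 2 < (m * n : ℝ) ∧ (m * n : ℝ) ≤ x),
          (∑ t ∈ Nat.finMulAntidiag k m, ∏ i, υ i (t i)) * (∑ t ∈ Nat.finMulAntidiag l n, ∏ j, υ' j (t j)) *
            (w (m * n) : ℂ)‖ ≤ x / Real.log x ^ B :=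
  hII (fun m => ∑ t ∈ Nat.finMulAntidiag k m, ∏ i, υ i (t i))
    (fun n => ∑ t ∈ Nat.finMulAntidiag l n, ∏ j, υ' j (t j))
    (fun m => norm_tupleCoeff_le_rpow υ hυ hB0 hBk m) (fun n => norm_tupleCoeff_le_rpow υ' hυ' hB0 hBl n)

/-! ### The second half of (w): `w_n ≥ −x^{ν/10}` — free for `w = a − 1`, `a ≥ 0` -/

/-- For a non-negative sequence `a`, `x ≥ 1` and `ν ≥ 0`, the sequence `w = a − 1` satisfies the SECOND half of
Ford–Maynard's growth condition (w), `w_n ≥ −x^{ν/10}` (p. 5) — the hypothesis the registered `stub_typeIIRegion`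
omits (its `GrowthBound` is only the first half) and which the skeleton's composition can supply for free, since it
applies the stub only to `w = a − 1` with `a ≥ 0`. [cite: FordMaynard2024PrimeSieves, §2 condition (w)] -/
theorem neg_rpow_le_sub_one {a : ℕ → ℝ} (ha : ∀ n, 0 ≤ a n) {x ν : ℝ} (hx : 1 ≤ x) (hν : 0 ≤ ν) (n : ℕ) :
    -(x ^ (ν / 10)) ≤ a n - 1 := by
  have h1 : (1 : ℝ) ≤ x ^ (ν / 10) := Real.one_le_rpow hx (by positivity)
  linarith [ha n]

/-- Lemma 7.10's use of (w): `w ≥ −M` with `M ≥ 0` gives `|w| ≤ w + 2M`.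
[cite: FordMaynard2024PrimeSieves, proof of Lemma 7.10 ("By (w), |w_n| ≤ w_n + 2x^{ν/10}")] -/
theorem abs_le_self_add_two_mul {w M : ℝ} (hM : 0 ≤ M) (hw : -M ≤ w) : |w| ≤ w + 2 * M := by
  rcases le_or_gt 0 w with h | h
  · rw [abs_of_nonneg h]; linarith
  · rw [abs_of_neg h]; linarith

/-- Summed form: `∑_{n ∈ S} |w_n| ≤ ∑_{n ∈ S} w_n + 2 M #S` when `w_n ≥ −M` on `S` (`M ≥ 0`) — how the mass of `|w|`
on an exceptional set `S` is controlled by a (Type-I) bound for `∑_{n ∈ S} w_n` plus the trivial `2M #S`.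
[cite: FordMaynard2024PrimeSieves, proof of Lemma 7.10 (the terms S₃, S₄)] -/
theorem sum_abs_le_sum_add {S : Finset ℕ} {w : ℕ → ℝ} {M : ℝ} (hM : 0 ≤ M) (hw : ∀ n ∈ S, -M ≤ w n) :
    ∑ n ∈ S, |w n| ≤ ∑ n ∈ S, w n + 2 * M * (S.card : ℝ) := by
  calc ∑ n ∈ S, |w n| ≤ ∑ n ∈ S, (w n + 2 * M) :=
        Finset.sum_le_sum fun n hn => abs_le_self_add_two_mul hM (hw n hn)
    _ = ∑ n ∈ S, w n + 2 * M * (S.card : ℝ) := by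
        rw [Finset.sum_add_distrib, Finset.sum_const, nsmul_eq_mul]; ring

end Summit.Parity.GeneralizedHardyLittlewood.FordMaynardSieveConst01651SieveConst01651

end

namespace Summit.Parity.GeneralizedHardyLittlewood.FordMaynardSieveConst01651SieveConst01651

/-! ### Appended: crude consequences of the first half of (w) (`GrowthBound`) -/

/-- **Crude bound from (w)**: on any subset `S` of the window `x/2 < n ≤ x`, `∑_{n ∈ S} |w_n| ≤ x (log x)^ϖ`
(drop `τ(n) ≥ 1` and the other terms). Used throughout §7 to discard exceptional sets ("`≪ x^{−99}`" terms, the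
hypothesis `|α_{n,m}| ≤ x²` of Lemma 7.9). [cite: FordMaynard2024PrimeSieves, §2 condition (w) and proof of Proposition 7.22 ("the crude bound |w_n| ≪ x^{1.1} which follows from (w)")] -/
theorem sum_abs_le_of_growthBound {w : ℕ → ℝ} {x ϖ : ℝ}
    (hw : Literature.NumberTheory.Sieve.FordMaynard.GrowthBound w x ϖ) {S : Finset ℕ}
    (hS : S ⊆ (Finset.Icc 1 ⌊x⌋₊).filter (fun n : ℕ => x / 2 < (n : ℝ))) :
    ∑ n ∈ S, |w n| ≤ x * Real.log x ^ ϖ := by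
  refine le_trans ?_ hw
  calc ∑ n ∈ S, |w n| ≤ ∑ n ∈ S, |w n| * (n.divisors.card : ℝ) := by
        refine Finset.sum_le_sum fun n hn => ?_
        have hn1 : 1 ≤ n := (Finset.mem_Icc.mp (Finset.mem_filter.mp (hS hn)).1).1
        have hτ : (1 : ℝ) ≤ (n.divisors.card : ℝ) := by
          exact_mod_cast Finset.card_pos.mpr ⟨1, Nat.one_mem_divisors.mpr (by omega)⟩
        exact le_mul_of_one_le_right (abs_nonneg _) hτ
    _ ≤ ∑ n ∈ (Finset.Icc 1 ⌊x⌋₊).filter (fun n : ℕ => x / 2 < (n : ℝ)), |w n| * (n.divisors.card : ℝ) :=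
        Finset.sum_le_sum_of_subset_of_nonneg hS fun n _ _ =>
          mul_nonneg (abs_nonneg _) (Nat.cast_nonneg _)

/-- **Pointwise crude bound from (w)**: for `x/2 < n ≤ x`, `|w_n| ≤ x (log x)^ϖ` ("`|w_n| ≪ x^{1.1}`").
[cite: FordMaynard2024PrimeSieves, proof of Proposition 7.22 (crude bound from (w))] -/
theorem abs_le_of_growthBound {w : ℕ → ℝ} {x ϖ : ℝ}
    (hw : Literature.NumberTheory.Sieve.FordMaynard.GrowthBound w x ϖ) {n : ℕ}
    (hn : n ∈ (Finset.Icc 1 ⌊x⌋₊).filter (fun n : ℕ => x / 2 < (n : ℝ))) :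
    |w n| ≤ x * Real.log x ^ ϖ := by
  have h := sum_abs_le_of_growthBound hw (Finset.singleton_subset_iff.mpr hn)
  rwa [Finset.sum_singleton] at h

end Summit.Parity.GeneralizedHardyLittlewood.FordMaynardSieveConst01651SieveConst01651
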